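import Summits.Ventures.CertifiedManyBodySolver.Upper.IntervalReaderPathSums

/-!
# Ventures/CertifiedManyBodySolver — Upper/IntervalReaderHubbardAutomaton.lean: E1's automaton, in tree vocabulary
(part 14 of the Theorem-H1′ package; parts 1–13: `IntervalReaderSchur` … `IntervalReaderPathSums`)

HONEST FRAMING: first certified bounds; not a superconductivity verdict; every number certified or labelled
float.  Definitions and bookkeeping lemmas only; no number is certified here, no row moves, nothing is said about
the Hubbard model's spectrum or the thermodynamic limit.

This file writes the finite automaton of `hubbard_mpo.py` (`mode_mpo`, composed over the two modes of a site by
`site_mpo`; l3core 0.6.5–0.6.9, unchanged since E1's engine notes) at SITE level in the tree's one-site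
Jordan–Wigner matrices (`siteCreation`, `siteAnnihilation`, `siteParity`, part 9's `hopFamily`), for hopping
weights `w x y` (read for `x < y`; E1's `W_ab` per same-spin mode pair) and on-site words `V k` (E1's
`A_x n_↑n_↓ + B_x (n_↑+n_↓) + C_x`, the `START → FINAL` row):

* `HState N = Bool ⊕ (Bool × Fin N × Fin 2)` — `FINAL`, `START`, and per orbital `(x, σ)` the channels
  `dag x σ` («`c†_{xσ}` placed at `x`, string running, awaiting `c_{yσ}` at a partner `y > x`», E1's `('dag', 2x+σ)`)
  and `ann x σ` (E1's `('ann', 2x+σ)`).  One GLOBAL alphabet for all cuts; E1 re-indexes the live channels densely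
  per cut (`alloc`), which by the liveness lemmas below only drops zero rows and columns.
* `hubbardAutomaton w V k` — the transition table at site `k`, row by row E1's: `fin → fin : 1`, `start → start : 1`,
  `start → fin : V k`; open `start → dag k σ : c†_σ F`, `start → ann k σ : F c_σ` iff a partner `y > k` with
  `w k y ≠ 0` exists (`if m in partners`); pass `dag/ann x σ → itself : F` for `x < k` iff a partner `y > k` remains
  (`last_partner[a] > m`); close `dag x σ → fin : −w x k • c_σ`, `ann x σ → fin : −w x k • c†_σ` for `x < k`
  (`(bidx, FINAL, mscale2(-W, A_))` / `(…, mscale2(-W, AD))`); everything else `0`.  The `4 × 4` rows are E1's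
  integer tables read in the tree's site basis `|0⟩,|↑⟩,|↓⟩,|↑↓⟩` (E1 orders `s = 2 n_↑ + n_↓`, i.e. `|0⟩,|↓⟩,|↑⟩,|↑↓⟩`:
  a fixed permutation of the middle two indices — a sixteen-entry check per row kept in the lineage card, not a
  premise here); `den` is not needed over `ℂ` (it only makes E1's table integral).
* depth one: `hubbardAutomaton_fin_of_ne` (`FINAL` absorbing), `hubbardAutomaton_channel_of_ne` (a channel moves
  only to itself or to `FINAL`) — the hypotheses of part 13's `automatonKernel_source_apply`;
* liveness: `hubbardAutomaton_to_dead` (no transition enters a channel with no partner ahead),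
  `hubbardAutomaton_from_dead` (none leaves a channel that was dead at the incoming cut), `automatonStep_dead`
  (so the exact environment of a dead channel is `0`: assigning the reader's absent environments the value `0`
  there costs no defect in part 12's hypotheses `hρ`, `hr`).

Part 15 (`IntervalReaderHubbardKernel`) proves that the `(START, FINAL)` kernel entry of this automaton is the
Hamiltonian and closes the multi-state route end to end.
-/

noncomputable section

open Matrix Finset
open scoped BigOperators ComplexOrder

namespace Summit.Ventures.CertifiedManyBodySolver.Upper.IntervalReader

open Literature.MathematicalPhysics.QuantumLattice
open Literature.MathematicalPhysics.QuantumLattice.JordanWigner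

/-! ## §BB  E1's Hubbard automaton at site level -/

section Hubbard

variable {N : ℕ}

/-- The states of E1's automaton (`hubbard_mpo.py`), one global alphabet for all cuts:
`Sum.inl false` = `FINAL`, `Sum.inl true` = `START`, `Sum.inr (false, x, σ)` = the channel `('dag', 2x+σ)`,
`Sum.inr (true, x, σ)` = the channel `('ann', 2x+σ)`.  (E1 re-indexes the LIVE channels densely at every cut;
by `hubbardAutomaton_to_dead` / `_from_dead` below that compression drops only zero rows and columns.) -/
abbrev HState (N : ℕ) : Type := Bool ⊕ (Bool × Fin N × Fin 2)

/-- `FINAL`: only identities follow. -/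
abbrev HState.fin : HState N := Sum.inl false

/-- `START`: only identities precede. -/
abbrev HState.start : HState N := Sum.inl true

/-- The channel «`c†_{xσ}` placed at site `x`, string running, awaiting `c_{yσ}` at a partner `y > x`»
(E1's `('dag', 2x+σ)`). -/
abbrev HState.dag (x : Fin N) (σ : Fin 2) : HState N := Sum.inr (false, x, σ)

/-- The channel «`c_{xσ}` placed at site `x`, string running, awaiting `c†_{yσ}` at a partner `y > x`»
(E1's `('ann', 2x+σ)`). -/
abbrev HState.ann (x : Fin N) (σ : Fin 2) : HState N := Sum.inr (true, x, σ)

/-- `START ≠ FINAL`. -/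
theorem HState.start_ne_fin : (HState.start : HState N) ≠ HState.fin := by
  simp

open Classical in
/-- **E1's automaton at site level** (`hubbard_mpo.py` `mode_mpo`, composed over the two modes of a site by
`site_mpo`), for hopping weights `w x y` (read for `x < y`; the word is `−w x y Σ_σ (c†_{xσ} c_{yσ} + c†_{yσ} c_{xσ})`)
and on-site words `V k` (`START → FINAL`), in the tree's one-site matrices: `fin → fin : 1`, `start → start : 1`,
`start → fin : V k`, open `start → dag k σ : c†_σ F` / `start → ann k σ : F c_σ` (iff a partner lies ahead),
pass `dag x σ → dag x σ : F` / `ann x σ → ann x σ : F` (for `x < k`, iff a partner still lies ahead),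
close `dag x σ → fin : −w x k • c_σ` / `ann x σ → fin : −w x k • c†_σ` (for `x < k`), everything else `0`. -/
def hubbardAutomaton (w : Fin N → Fin N → ℂ) (V : Fin N → Matrix (Fin 4) (Fin 4) ℂ) (k : Fin N) :
    HState N → HState N → Matrix (Fin 4) (Fin 4) ℂ
  | Sum.inl false, Sum.inl false => 1
  | Sum.inl true, Sum.inl true => 1
  | Sum.inl true, Sum.inl false => V k
  | Sum.inl true, Sum.inr (false, x, σ) => if x = k ∧ (∃ y, k < y ∧ w k y ≠ 0) then siteCreation σ * siteParity else 0
  | Sum.inl true, Sum.inr (true, x, σ) => if x = k ∧ (∃ y, k < y ∧ w k y ≠ 0) then siteParity * siteAnnihilation σ else 0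
  | Sum.inr (false, x, σ), Sum.inr (false, x', σ') =>
      if x' = x ∧ σ' = σ ∧ x < k ∧ (∃ y, k < y ∧ w x y ≠ 0) then siteParity else 0
  | Sum.inr (true, x, σ), Sum.inr (true, x', σ') =>
      if x' = x ∧ σ' = σ ∧ x < k ∧ (∃ y, k < y ∧ w x y ≠ 0) then siteParity else 0
  | Sum.inr (false, x, σ), Sum.inl false => if x < k then (-(w x k)) • siteAnnihilation σ else 0
  | Sum.inr (true, x, σ), Sum.inl false => if x < k then (-(w x k)) • siteCreation σ else 0
  | Sum.inl false, Sum.inl true => 0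
  | Sum.inl false, Sum.inr _ => 0
  | Sum.inr _, Sum.inl true => 0
  | Sum.inr (false, _, _), Sum.inr (true, _, _) => 0
  | Sum.inr (true, _, _), Sum.inr (false, _, _) => 0

variable (w : Fin N → Fin N → ℂ) (V : Fin N → Matrix (Fin 4) (Fin 4) ℂ)

/-- Table entry `fin → fin = 1`. -/
@[simp] theorem hubbardAutomaton_fin_fin (k : Fin N) :
    hubbardAutomaton w V k HState.fin HState.fin = 1 := rfl

/-- Table entry `start → start = 1`. -/
@[simp] theorem hubbardAutomaton_start_start (k : Fin N) :
    hubbardAutomaton w V k HState.start HState.start = 1 := rfl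

/-- Table entry `start → fin = V k` (the on-site word). -/
@[simp] theorem hubbardAutomaton_start_fin (k : Fin N) :
    hubbardAutomaton w V k HState.start HState.fin = V k := rfl

open Classical in
/-- Table entry: opening a `dag` channel. -/
theorem hubbardAutomaton_start_dag (k x : Fin N) (σ : Fin 2) :
    hubbardAutomaton w V k HState.start (HState.dag x σ) =
      if x = k ∧ (∃ y, k < y ∧ w k y ≠ 0) then siteCreation σ * siteParity else 0 := rfl

open Classical in
/-- Table entry: opening an `ann` channel. -/
theorem hubbardAutomaton_start_ann (k x : Fin N) (σ : Fin 2) :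
    hubbardAutomaton w V k HState.start (HState.ann x σ) =
      if x = k ∧ (∃ y, k < y ∧ w k y ≠ 0) then siteParity * siteAnnihilation σ else 0 := rfl

open Classical in
/-- Table entry: a `dag` channel passing a site. -/
theorem hubbardAutomaton_dag_dag (k x : Fin N) (σ : Fin 2) :
    hubbardAutomaton w V k (HState.dag x σ) (HState.dag x σ) = if x < k ∧ (∃ y, k < y ∧ w x y ≠ 0) then siteParity else 0 := by
  simp [hubbardAutomaton]

open Classical in
/-- Table entry: an `ann` channel passing a site. -/
theorem hubbardAutomaton_ann_ann (k x : Fin N) (σ : Fin 2) :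
    hubbardAutomaton w V k (HState.ann x σ) (HState.ann x σ) = if x < k ∧ (∃ y, k < y ∧ w x y ≠ 0) then siteParity else 0 := by
  simp [hubbardAutomaton]

/-- Table entry: a `dag` channel closing. -/
theorem hubbardAutomaton_dag_fin (k x : Fin N) (σ : Fin 2) :
    hubbardAutomaton w V k (HState.dag x σ) HState.fin = if x < k then (-(w x k)) • siteAnnihilation σ else 0 :=
  rfl

/-- Table entry: an `ann` channel closing. -/
theorem hubbardAutomaton_ann_fin (k x : Fin N) (σ : Fin 2) :
    hubbardAutomaton w V k (HState.ann x σ) HState.fin = if x < k then (-(w x k)) • siteCreation σ else 0 :=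
  rfl

/-- `FINAL` is absorbing. -/
theorem hubbardAutomaton_fin_of_ne (k : Fin N) :
    ∀ c : HState N, c ≠ HState.fin → hubbardAutomaton w V k HState.fin c = 0
  | Sum.inl false, h => absurd rfl h
  | Sum.inl true, _ => rfl
  | Sum.inr (false, _, _), _ => rfl
  | Sum.inr (true, _, _), _ => rfl

/-- Channels move only to themselves or to `FINAL` (the automaton has depth one). -/
theorem hubbardAutomaton_channel_of_ne (k : Fin N) : ∀ b c : HState N,
    b ≠ HState.start → b ≠ HState.fin → c ≠ b → c ≠ HState.fin → hubbardAutomaton w V k b c = 0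
  | Sum.inl false, _, _, h, _, _ => absurd rfl h
  | Sum.inl true, _, h, _, _, _ => absurd rfl h
  | Sum.inr (false, _, _), Sum.inl false, _, _, _, h => absurd rfl h
  | Sum.inr (true, _, _), Sum.inl false, _, _, _, h => absurd rfl h
  | Sum.inr (false, _, _), Sum.inl true, _, _, _, _ => rfl
  | Sum.inr (true, _, _), Sum.inl true, _, _, _, _ => rfl
  | Sum.inr (false, _, _), Sum.inr (true, _, _), _, _, _, _ => rfl
  | Sum.inr (true, _, _), Sum.inr (false, _, _), _, _, _, _ => rfl
  | Sum.inr (false, x, σ), Sum.inr (false, x', σ'), _, _, h, _ => by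
      simp only [hubbardAutomaton]
      rw [if_neg]
      rintro ⟨rfl, rfl, -⟩
      exact h rfl
  | Sum.inr (true, x, σ), Sum.inr (true, x', σ'), _, _, h, _ => by
      simp only [hubbardAutomaton]
      rw [if_neg]
      rintro ⟨rfl, rfl, -⟩
      exact h rfl

/-- **No way into a dead channel.**  If after site `k` the channel of orbital `(x, σ)` has no partner ahead
(`¬ (x ≤ k ∧ (∃ y, k < y ∧ w x y ≠ 0))` — not yet opened, or E1's `last_partner` passed), no transition at site `k` enters it. -/
theorem hubbardAutomaton_to_dead (k x : Fin N) (σ : Fin 2) (h : ¬ (x ≤ k ∧ (∃ y, k < y ∧ w x y ≠ 0))) :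
    ∀ b : HState N, hubbardAutomaton w V k b (HState.dag x σ) = 0 ∧ hubbardAutomaton w V k b (HState.ann x σ) = 0
  | Sum.inl false => ⟨rfl, rfl⟩
  | Sum.inl true => by
      refine ⟨?_, ?_⟩
      · rw [hubbardAutomaton_start_dag, if_neg]
        rintro ⟨rfl, hl⟩
        exact h ⟨le_rfl, hl⟩
      · rw [hubbardAutomaton_start_ann, if_neg]
        rintro ⟨rfl, hl⟩
        exact h ⟨le_rfl, hl⟩
  | Sum.inr (false, x', σ') => by
      refine ⟨?_, rfl⟩
      simp only [hubbardAutomaton]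
      rw [if_neg]
      rintro ⟨rfl, rfl, hlt, hl⟩
      exact h ⟨hlt.le, hl⟩
  | Sum.inr (true, x', σ') => by
      refine ⟨rfl, ?_⟩
      simp only [hubbardAutomaton]
      rw [if_neg]
      rintro ⟨rfl, rfl, hlt, hl⟩
      exact h ⟨hlt.le, hl⟩

/-- **No way out of a dead channel.**  If before site `k` the channel of orbital `(x, σ)` is dead (no partner at or
after `k`: `¬ (x < k ∧ ∃ y, k ≤ y ∧ w x y ≠ 0)`), every transition at site `k` out of it vanishes. -/
theorem hubbardAutomaton_from_dead (k x : Fin N) (σ : Fin 2) (h : ¬ (x < k ∧ ∃ y, k ≤ y ∧ w x y ≠ 0)) :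
    ∀ c : HState N, hubbardAutomaton w V k (HState.dag x σ) c = 0 ∧ hubbardAutomaton w V k (HState.ann x σ) c = 0
  | Sum.inl false => by
      have hk : x < k → w x k = 0 := fun hlt => by
        by_contra hne
        exact h ⟨hlt, k, le_rfl, hne⟩
      refine ⟨?_, ?_⟩
      · rw [hubbardAutomaton_dag_fin]
        split_ifs with hlt
        · rw [hk hlt, neg_zero, zero_smul]
        · rfl
      · rw [hubbardAutomaton_ann_fin]
        split_ifs with hlt
        · rw [hk hlt, neg_zero, zero_smul]
        · rfl
  | Sum.inl true => ⟨rfl, rfl⟩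
  | Sum.inr (false, x', σ') => by
      refine ⟨?_, rfl⟩
      simp only [hubbardAutomaton]
      rw [if_neg]
      rintro ⟨rfl, rfl, hlt, y, hy, hne⟩
      exact h ⟨hlt, y, hy.le, hne⟩
  | Sum.inr (true, x', σ') => by
      refine ⟨rfl, ?_⟩
      simp only [hubbardAutomaton]
      rw [if_neg]
      rintro ⟨rfl, rfl, hlt, y, hy, hne⟩
      exact h ⟨hlt, y, hy.le, hne⟩

/-- A sweep step into a state nothing enters is the zero environment, whatever the incoming family: dead channels
carry the exact environment `0`, so setting the reader's (absent) environment there to `0` costs no defect. -/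
theorem automatonStep_dead {D : ℕ} (A : MPSTensor 4 D) (Ok : HState N → HState N → Matrix (Fin 4) (Fin 4) ℂ)
    (c : HState N) (hc : ∀ b, Ok b c = 0) (Y : HState N → Matrix (Fin D) (Fin D) ℂ) :
    ∑ b, transferOp A (Ok b c) (Y b) = 0 :=
  Finset.sum_eq_zero fun b _ => by rw [hc b]; simp [transferOp]

end Hubbard

end Summit.Ventures.CertifiedManyBodySolver.Upper.IntervalReader

end
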